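import Summits.Parity.BatemanHorn.Theses.RoughValueTransport
import Literature.NumberTheory.Sieve.BombieriAsymptoticSieveSmoothPart

/-!
# Route `RoughValueTransport`, crux `RoughValueLaw` (stmt-Parity-11390), line `friable-deep-tail`:
# the registered stub `stub_typeISumSwap` (S2a)

`--supports` file of the checked skeleton
`Summits/Parity/BatemanHorn/Cruxes/RoughValueLaw/Lines/friable-deep-tail.lean`
(crux `Summit.Parity.BatemanHorn.Theses.RoughValueTransport.RoughValueLaw`).  It PROVES the
registered stub S2a verbatim: the EXACT double-counting swap of the level-`D` Type-I sum,
`Σ_{1 ≤ n ≤ x, all fᵢ(n) > 0} Σ_{d⃗ : dᵢ ∣ sᵢ(n) ∀ i, ∏ dᵢ ≤ D} ∏ μ(dᵢ)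
  = Σ_{d⃗ ∈ [1,D]^k, ∏ dᵢ ≤ D, all prime factors of dᵢ < Bᵢ} (∏ μ(dᵢ)) ·
      #{1 ≤ n ≤ x : all fᵢ(n) > 0 and all dᵢ ∣ fᵢ(n)}`,
where `sᵢ(n) = smoothPart (B i) (fᵢ(n)).toNat` is the `Bᵢ`-friable part of the value
(tree file `Literature/NumberTheory/Sieve/BombieriAsymptoticSieveSmoothPart.lean`).

## The argument (pure combinatorics; no hypothesis on `f`)

* `dvd_smoothPart_iff`: for `N ≠ 0`, `d ∣ smoothPart B N ↔ d ∣ N ∧` every prime factor of `d` is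
  `< B` (from the tree API `smoothPart_dvd`, `smoothPart_mem_smoothNumbers`,
  `not_dvd_div_smoothPart`, `smoothPart_mul_div` and `Nat.Coprime.dvd_of_dvd_mul_right`).
* `mem_divisors_smoothPart_toNat_iff`: the same over a positive integer value `z`, through
  `(d : ℤ) ∣ z ↔ d ∣ z.toNat`.
* `mem_divisorTuples_iff`: the pointwise re-indexing of the tuples `d⃗` (coordinate-wise, plus
  `1 ≤ dᵢ ≤ ∏ dⱼ ≤ D`).
* `stub_typeISumSwap`: `Finset.sum_comm'` with that re-indexing, then `Finset.sum_const`.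

Everything used is PROVED in the tree (Mathlib + the `smoothPart` API); no definition and no new
fact is introduced.
-/

noncomputable section

open Filter Finset Polynomial
open scoped BigOperators

namespace Summit.Parity.BatemanHorn.Cruxes.RoughValueLaw.FriableDeepTail

open Literature.NumberTheory.Sieve

/-- **Divisors of the smooth part.**  For `N ≠ 0`: `d ∣ smoothPart B N` iff `d ∣ N` and every
prime factor of `d` is `< B`. [folklore] -/
theorem dvd_smoothPart_iff {B N d : ℕ} (hN : N ≠ 0) :
    d ∣ smoothPart B N ↔ d ∣ N ∧ ∀ p ∈ d.primeFactors, p < B := by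
  constructor
  · intro hd
    refine ⟨hd.trans (smoothPart_dvd hN B), fun p hp => ?_⟩
    have hp' := Nat.mem_primeFactors.mp hp
    exact (Nat.mem_smoothNumbers'.mp (smoothPart_mem_smoothNumbers B N)) p hp'.1
      (hp'.2.1.trans hd)
  · rintro ⟨hdN, hB⟩
    have hd0 : d ≠ 0 := by
      rintro rfl
      exact hN (zero_dvd_iff.mp hdN)
    have hcop : d.Coprime (N / smoothPart B N) :=
      Nat.coprime_of_dvd fun p hp hpd hpc =>
        not_dvd_div_smoothPart hp (hB p (Nat.mem_primeFactors.mpr ⟨hp, hpd, hd0⟩)) hN hpc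
    refine hcop.dvd_of_dvd_mul_right ?_
    rwa [smoothPart_mul_div hN B]

/-- Positivity transfer: if `(d : ℤ) ∣ z` with `z > 0` then `d > 0`. [folklore] -/
theorem pos_of_natCast_dvd {d : ℕ} {z : ℤ} (hz : 0 < z) (h : (d : ℤ) ∣ z) : 0 < d := by
  rcases Nat.eq_zero_or_pos d with rfl | hd
  · rw [Nat.cast_zero, zero_dvd_iff] at h
    exact absurd h hz.ne'
  · exact hd

/-- **Divisors of the friable part of a positive value.**  For `z > 0`:
`d ∈ (smoothPart B z.toNat).divisors ↔ (d : ℤ) ∣ z ∧` every prime factor of `d` is `< B`.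
[folklore] -/
theorem mem_divisors_smoothPart_toNat_iff {B d : ℕ} {z : ℤ} (hz : 0 < z) :
    d ∈ (smoothPart B z.toNat).divisors ↔ (d : ℤ) ∣ z ∧ ∀ p ∈ d.primeFactors, p < B := by
  obtain ⟨m, rfl⟩ := Int.eq_ofNat_of_zero_le hz.le
  have hm : m ≠ 0 := by
    rintro rfl
    simp at hz
  rw [Int.toNat_natCast, Nat.mem_divisors, Int.natCast_dvd_natCast, dvd_smoothPart_iff hm]
  exact ⟨fun h => h.1, fun h => ⟨h, smoothPart_ne_zero B m⟩⟩

/-- **The pointwise re-indexing.**  For a tuple of positive values `v`, the tuples `d⃗` with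
`dᵢ ∣ smoothPart (B i) (v i).toNat` for all `i` and `∏ dᵢ ≤ D` are exactly the tuples
`d⃗ ∈ [1, D]^k` with `∏ dᵢ ≤ D`, every prime factor of `dᵢ` below `B i`, and `(dᵢ : ℤ) ∣ v i`
for all `i`. [folklore] -/
theorem mem_divisorTuples_iff {k : ℕ} (v : Fin k → ℤ) (hv : ∀ i, 0 < v i) (B : Fin k → ℕ)
    (D : ℕ) (d : Fin k → ℕ) :
    ((d ∈ Fintype.piFinset fun i => (smoothPart (B i) (v i).toNat).divisors) ∧
        (∏ i, d i) ≤ D) ↔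
      ((d ∈ Fintype.piFinset fun _ : Fin k => Icc 1 D) ∧
          ((∏ i, d i) ≤ D ∧ ∀ i, ∀ p ∈ (d i).primeFactors, p < B i)) ∧
        ∀ i, ((d i : ℕ) : ℤ) ∣ v i := by
  have hB : ∀ i, d i ∈ (smoothPart (B i) (v i).toNat).divisors ↔
      ((d i : ℕ) : ℤ) ∣ v i ∧ ∀ p ∈ (d i).primeFactors, p < B i :=
    fun i => mem_divisors_smoothPart_toNat_iff (hv i)
  simp only [Fintype.mem_piFinset, hB, Finset.mem_Icc]
  constructor
  · rintro ⟨h, hD⟩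
    have h1 : ∀ i, 1 ≤ d i := fun i => pos_of_natCast_dvd (hv i) (h i).1
    exact ⟨⟨fun i => ⟨h1 i,
      (Finset.single_le_prod' (fun j _ => h1 j) (Finset.mem_univ i)).trans hD⟩,
      hD, fun i => (h i).2⟩, fun i => (h i).1⟩
  · rintro ⟨⟨-, hD, hB'⟩, hdv⟩
    exact ⟨fun i => ⟨hdv i, hB' i⟩, hD⟩

/-- **stub_typeISumSwap** (S2a; registered stub of the skeleton
`Cruxes/RoughValueLaw/Lines/friable-deep-tail.lean`, crux stmt-Parity-11390).  The exact
double-counting swap of the level-`D` Type-I sum: summing `∏ μ(dᵢ)` over the `1 ≤ n ≤ x` with all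
`fᵢ(n) > 0` and then over the divisor tuples `d⃗` of the friable parts `sᵢ(n)` with `∏ dᵢ ≤ D`
equals summing, over the tuples `d⃗ ∈ [1, D]^k` with `∏ dᵢ ≤ D` and all prime factors of `dᵢ`
below `Bᵢ`, of `(∏ μ(dᵢ)) · #{1 ≤ n ≤ x : all fᵢ(n) > 0, all dᵢ ∣ fᵢ(n)}`
(`Finset.sum_comm'` with `mem_divisorTuples_iff`, then `Finset.sum_const`). [folklore] -/
theorem stub_typeISumSwap :
    ∀ (k : ℕ) (f : Fin k → ℤ[X]) (B : Fin k → ℕ) (D x : ℕ),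
      (∑ n ∈ (Icc 1 x).filter (fun n : ℕ => ∀ i, 0 < (f i).eval (n : ℤ)),
          ∑ d ∈ (Fintype.piFinset fun i =>
              (smoothPart (B i) ((f i).eval (n : ℤ)).toNat).divisors) with (∏ i, d i) ≤ D,
            ∏ i, (ArithmeticFunction.moebius (d i) : ℤ)) =
        ∑ d ∈ (Fintype.piFinset fun _ : Fin k => Icc 1 D) with
            ((∏ i, d i) ≤ D ∧ ∀ i, ∀ p ∈ (d i).primeFactors, p < B i),
          (∏ i, (ArithmeticFunction.moebius (d i) : ℤ)) *
            ((#((Icc 1 x).filter (fun n : ℕ => (∀ i, 0 < (f i).eval (n : ℤ)) ∧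
                ∀ i, ((d i : ℕ) : ℤ) ∣ (f i).eval (n : ℤ))) : ℕ) : ℤ) := by
  intro k f B D x
  calc
    _ = ∑ d ∈ (Fintype.piFinset fun _ : Fin k => Icc 1 D) with
            ((∏ i, d i) ≤ D ∧ ∀ i, ∀ p ∈ (d i).primeFactors, p < B i),
          ∑ _n ∈ (Icc 1 x).filter (fun n : ℕ => (∀ i, 0 < (f i).eval (n : ℤ)) ∧
              ∀ i, ((d i : ℕ) : ℤ) ∣ (f i).eval (n : ℤ)),
            ∏ i, (ArithmeticFunction.moebius (d i) : ℤ) := by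
      refine Finset.sum_comm' fun n d => ?_
      simp only [Finset.mem_filter]
      constructor
      · rintro ⟨⟨hnx, hP⟩, hd⟩
        have h := (mem_divisorTuples_iff (fun i => (f i).eval (n : ℤ)) hP B D d).mp hd
        exact ⟨⟨hnx, hP, h.2⟩, h.1⟩
      · rintro ⟨⟨hnx, hP, hQ⟩, hd⟩
        exact ⟨⟨hnx, hP⟩,
          (mem_divisorTuples_iff (fun i => (f i).eval (n : ℤ)) hP B D d).mpr ⟨hd, hQ⟩⟩
    _ = _ := by
      refine Finset.sum_congr rfl fun d _ => ?_
      rw [Finset.sum_const, nsmul_eq_mul, mul_comm]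

end Summit.Parity.BatemanHorn.Cruxes.RoughValueLaw.FriableDeepTail
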